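import Summits.BirchSwinnertonDyer.Rank1Residual.ManinAdditive.TowerUnitTwist
import Mathlib.RingTheory.Localization.Away.Basic
import Mathlib.LinearAlgebra.Matrix.SpecialLinearGroup
import Mathlib.RingTheory.Coprime.Basic
import Mathlib.Algebra.Polynomial.Basic
import HarnessLib
import HarnessLib.Audit.Tags

/-!
# THE EXTENSION STEP OF THE q-TOWER LAW: E-an-135♭ (∃q-form), TOWER RIGIDITY core E-an-139a, the q-FAREY fibre law
# E-an-140 and the S-ARITHMETIC Borel generation E-an-141 — typed (an g30, MEMO-an §72; cell `bsd-f2-manin`, T-an-34, typer g15)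

HONEST FRAMING.  LENS = analytic / Waldspurger–Gross–Zagier (`bsd-f2-manin-an` g30, MEMO-an §72, PROOFS-an-72.md
847c11b0ca2f0f44, «DELIVERED §72» 2026-08-28T21:35:50Z + ADDENDUM §72.6 21:44:10Z).  SOURCE = HOME/an/g30/Sketch-an-g30.lean
sha16 230c0aa8f984dbd4 (194 l.; farm rc 0 · 0 · 0 · 0 per an; BC7 g30-bc7.raw.txt), §1–§4 VERBATIM except: namespace
`BsdF2ManinAnG30` ↦ `…ManinAdditive.KatoCurve` (§1, next to E-an-135 `KatoCurve.TowerUnitTwist`) and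
`…ManinAdditive.TowerExtension` (§2–§4); the four ROWS are tagged `@[conjecture]` (obligation nodes, NOTHING ASSERTED);
the ∃q-schema E-an-135♭ gets the typer's vacuity guard `p.Prime →` (at `p = 1` the unguarded body is junk-FALSE via
`¬ 1 ∣ (q−1)/2`; REF1 §R31/§R42/§R89 drill — consumers feed `Nat.prime_three` / `Nat.prime_two`); this header replaces
the sketch's.  §5 of the sketch (two statement-only literature facts `UnipotentsFiniteIndexFact` [Venkataramana 1994 /
Vaserstein 1972], `CongruenceSubgroupPropertyFact` [Serre 1970 Thm 2 Cor 3] and the edge `FactsImplyBorelGeneration`) is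
NOT LANDED — superseded by TREE THEOREMS (DEDUP / D-0026): Serre's congruence subgroup property for `SL₂(ℤ[1/m])`,
`m ≥ 2`, is `Literature.NumberTheory.Automorphic.SerreSL2Congruence1970_congruenceSubgroupProperty_away_holds` (PROVED,
cell bsd-print-x8), and Vaserstein's relative elementary theorem over `ℤ[1/m]` is
`Literature.NumberTheory.Automorphic.SL2Rel.Away.relG_top_span_natCast_le_relE : ∀ m ≥ 2, ∀ N ≠ 0, G(ℤ[1/m], (N)) ≤
E(ℤ[1/m], (N))` (PROVED) — from which **E-an-141 follows OUTRIGHT** (torus move `diag(q^{∓e}, q^{±e}) ∈ B⁺` to reach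
`d ≡ 1 (mod N)`, then `G(A,(N)) ≤ E(A,(N)) = ⟨E₁₂(A), E₂₁((N))⟩ ≤ ⟨B⁺ ∪ U⁻(N)⟩`): sibling `TowerExtensionHolds.lean`,
`TowerExtension.sArithBorelGeneration_holds : ∀ N q, SArithBorelGeneration N q` (typer g15, PROVED), together with
E-an-139a `affineRecurrenceRigidity_holds` (2×2 linear algebra, PROVED there) when landed.

ROWS (an's text, abridged; why-it-might-fail clauses in the per-row docstrings):
* §1 **E-an-135♭ `KatoCurve.SomeTowerUnitTwist p`** — the ∃q-form of the tree's E-an-135 `KatoCurve.TowerUnitTwist p`: what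
  the landed reductions `threeAdicWitness_of_towerUnitTwist` / `…_of_towerUnitTwist'` (p2 p665743) actually consume is ONE
  prime `q ≡ 2 (3)` [`q ≡ 3 (4)`], `q > N + 3`; §72 proves E-an-135 only for a Chebotarev set of `q` (the (EV_q)-primes,
  §72.6: at every (EV_q)-prime modulo the Lean transcription of THEOREM Z + (GEN𝒵)), so the ∃q-form is the right obligation;
  `KatoCurve.TowerImpliesSome` (E-an-135 ⟹ E-an-135♭, Dirichlet) is bookkeeping for p2.  TOWER-an-g29 74/74, 52/52.
* §2 **E-an-139a `TowerExtension.AffineRecurrenceRigidity`** — THEOREM (support; §72.2 step 4): a `w`-periodic order-two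
  affine recurrence `q·x_{m+2} = a·x_{m+1} − x_m + κ` is constant when `X² − aX + q` and `X^w − 1` are coprime.
* §3 **E-an-140 `TowerExtension.QFareyFibreConnected N q`** — the `q`-Farey graph on the reduced fractions `B/D` with
  `D mod N ∈ ±⟨q⟩` is connected (BC5: HOME/an/g30/QFAREY-an-g30.txt BFS/path tables for six `(N, q)`); THEOREM modulo
  E-an-141 by the orbit-graph lemma (§72.3, paper) — with E-an-141 proved in the sibling, the edge
  `BorelGenerationImpliesConnected` IS the remaining content (`qFareyFibreConnected_of_borelGenerationImpliesConnected`).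
* §4 **E-an-141 `TowerExtension.SArithBorelGeneration N q`** — in `SL₂(ℤ[1/q])`, `⟨B⁺(ℤ[1/q]) ∪ U⁻(Nℤ[1/q])⟩ ⊇
  Γ_S^{±q}(N) = {γ₁₀ ∈ (N), γ₁₁ ∈ ±q^ℕ + (N)}`.  THEOREM of the tree (sibling `TowerExtensionHolds`), not a law any more.
APPEND (T-an-34″, source sha16 43bd003eb6244594 §6): **E-an-142** `TVPatternRigidity N q p` (schema) / `TVPatternRigidityLaw p`
(@[conjecture]) — CELL-FREE TV-pattern rigidity replacing (EV_q) —, `TowerUnitTwistGeFive p`, the paper edge `RigidityImpliesTower`,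
and PROVED typer edges `towerUnitTwistGeFive_of_towerUnitTwist`, `someTowerUnitTwist_of_geFive` (GeFive ⟹ E-an-135♭, Dirichlet).
Sibling `TowerExtensionHolds.lean` (p672172): E-an-141, E-an-139a, `TowerImpliesSome` PROVED.
Chain (§72.4): E-an-141 ⟹ E-an-140 ⟹ (GEN𝒵); TV_{≥n₁} ∧ (EV_q) ⟹ (THEOREM Z, core E-an-139a) Φ ≡ 0 on Δ₀(𝒵) ⟹ (GEN𝒵)
φ⁺ mod p is Shimura-type ⟹ p ∣ d — contradiction; hence E-an-135 at every (EV_q)-prime and E-an-135♭ in the generic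
Chebotarev cell (p = 3: ρ̄₃ ⊇ SL₂(𝔽₃); p = 2: E(ℚ)[2] = 0 ∧ Δ ≠ −□, cubic-cyclic sub-case open).
NOT IN PRINT (an, MEMO-an §72 placement): the q-tower unit-twist law and its extension step are the cell's; nearest print by
name: Ash–Stevens, Duke 53 (1986) / Stevens 1985 (cuspidal-group generation, `p ∤ N` hypotheses); the S-arithmetic inputs are
Serre, Ann. of Math. 92 (1970) Thm 2 Cor 3 and Vaserstein 1972 / Liehl 1981 — both now TREE THEOREMS over `ℤ[1/m]` (above);
Venkataramana, Pacific J. Math. 166 (1994) Thm p. 194 (held, read by an) is the general finite-index statement, not needed here.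
REFUTER VERDICTS: REF1 R-an-52 PENDING at filing (by-name BC7 on these names requested) — a finding is repaired under a NEW name
(append-only); REF1 §R89 N3 (an g29 audit) already endorsed the ∃q-form.  bears_on: stmt-BirchSwinnertonDyer-22967 / -22968
(the tower input h135 / h135₂ of TURNKEY-an-16; p2 g10 re-runs the reductions from the ∃q-form).  PARTITION 0 · beyond-print
theorem: no (typer; E-an-141's proof is a corollary of the tree's Vaserstein theorem) · BSD is not proved by this; Manin's
conjecture is not proved by this; C2/C3 remain OPEN.
-/

set_option autoImplicit false

noncomputable section

open scoped Classical MatrixGroups ModularForm ComplexConjugate Polynomial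

open CongruenceSubgroup Complex WeierstrassCurve Literature.NumberTheory.EllipticCurves
  Literature.NumberTheory.EllipticCurves.ModularForms
  Summit.BirchSwinnertonDyer.Rank1Residual.ManinAdditive.KatoCurve

namespace Summit.BirchSwinnertonDyer.Rank1Residual.ManinAdditive.KatoCurve

/-! ### §1. E-an-135♭ — the ∃q-form of the tower unit-twist law -/

/-- **E-an-135♭ `SomeTowerUnitTwist p`**: for the newform `f` of `W` with plus index prime to `p` there are
ARBITRARILY LARGE odd primes `q ≠ p`, `q ∤ N`, `p ∤ (q-1)/2`, whose conductor tower `qⁿ` carries even primitive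
characters with a `p`-unit normalised twisted value at arbitrarily high level (the tree's `UnitTwistAt`).
Why it might fail: only in the EXCEPTIONAL CELLS of §72.4 (`p = 3`: `ρ̄_{E,3}` reducible or with image in the
normaliser of a split Cartan; `p = 2`: rational 2-torsion, `Δ_E = -□`, or cyclic cubic `ℚ(E[2]) ⊂ ℚ(μ_N)`), where no
prime satisfies (EV_q) and the §72 proof is silent — the statement itself has no known failure (TOWER-an-g29: 74/74,
52/52).  Sources: MEMO-an §71.4, §72; Ash–Stevens, Duke 53 (1986); Serre, Ann. Math. 92 (1970).
TYPER FRAMING (E-an-135♭): lens an; LAW (obligation node), nothing asserted; vacuity guard `p.Prime →` added by the typer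
(unguarded the schema is junk-false at `p = 1`); BC5 / REF1 status in the file header. [conjecture — cell candidate, NOT a tree fact] -/
@[conjecture]
def SomeTowerUnitTwist (p : ℕ) : Prop :=
  p.Prime → ∀ (W : WeierstrassCurve ℚ) [W.IsElliptic] {N : ℕ} [NeZero N] (f : CuspForm (Gamma0 N) 2),
    IsNewformOf W f → PlusIndexPrimeTo p f →
    ∀ N₀ : ℕ, ∃ (q : ℕ) (_ : Fact q.Prime), N₀ < q ∧ q ≠ 2 ∧ q ≠ p ∧ ¬ q ∣ N ∧ ¬ p ∣ (q - 1) / 2 ∧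
      ∀ n₁ : ℕ, ∃ n : ℕ, n₁ ≤ n ∧
        ∃ χ : DirichletCharacter ℂ (q ^ n), χ.IsPrimitive ∧ χ.Even ∧ UnitTwistAt p W f χ

/-- The bookkeeping edge E-an-135 ⟹ E-an-135♭ (Dirichlet: primes `q ≡ 2 (mod 3)` / `q ≡ 3 (mod 4)` / `q ≡ -1
(mod 4p)` beyond any bound), recorded as a Prop for -ty. -/
def TowerImpliesSome : Prop := ∀ p : ℕ, p.Prime → TowerUnitTwist p → SomeTowerUnitTwist p

end Summit.BirchSwinnertonDyer.Rank1Residual.ManinAdditive.KatoCurve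

namespace Summit.BirchSwinnertonDyer.Rank1Residual.ManinAdditive.TowerExtension

/-! ### §2. E-an-139a — rigidity of a periodic affine recurrence (the algebraic core of THEOREM Z) -/

/-- **E-an-139a `AffineRecurrenceRigidity`** (THEOREM, §72.2 step 4).  Over a field `K` with `q ≠ 0`: if
`q·x(m+2) = a·x(m+1) - x(m) + κ` for all `m ≥ s`, `x(m + w) = x(m)` for all `m ≥ s` (`w ≥ 1`), and the
polynomials `X² - aX + q` and `X^w - 1` are coprime in `K[X]` (hypothesis (EV): no root `λ` of the Frobenius
polynomial with `λ^w = 1`), then `x` is constant from `s` on and `(q + 1 - a)·x(s) = κ`.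
Proof: the state `(x(m+1), x(m))` is a `w`-periodic point of the affine map `Ψ(u,v) = ((a u - v + κ)/q, u)` whose
linear part has eigenvalues `1/λ`; (EV) makes `Ψ^w - id` injective, so the periodic point is the unique fixed point
`(x*, x*)`, `(q+1-a)x* = κ`.  Why it might fail: it cannot (linear algebra); typed as a support item.
TYPER FRAMING (E-an-139a): support THEOREM typed as an obligation node (nothing asserted here); discharged in the sibling
`TowerExtensionHolds.lean` (`affineRecurrenceRigidity_holds`) when landed. [conjecture — cell candidate, NOT a tree fact] -/
@[conjecture]
def AffineRecurrenceRigidity : Prop :=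
  ∀ (K : Type) [Field K] (a q κ : K) (w s : ℕ) (x : ℕ → K),
    q ≠ 0 → 0 < w →
    (∀ m : ℕ, s ≤ m → q * x (m + 2) = a * x (m + 1) - x m + κ) →
    (∀ m : ℕ, s ≤ m → x (m + w) = x m) →
    IsCoprime (Polynomial.X ^ 2 - Polynomial.C a * Polynomial.X + Polynomial.C q : Polynomial K) (Polynomial.X ^ w - 1) →
    (∀ m : ℕ, s ≤ m → x m = x s) ∧ (q + 1 - a) * x s = κ

/-! ### §3. E-an-140 — connectivity of the q-Farey graph on a denominator fibre -/

/-- `InFibre N q D`: the denominator `D` is prime to `N` and `D mod N ∈ ±⟨q⟩ ⊂ (ℤ/N)ˣ` (the `ι`-fibre of `0`). -/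
def InFibre (N q D : ℕ) : Prop :=
  Nat.Coprime D N ∧ ∃ e : ℕ, (D : ZMod N) = (q : ZMod N) ^ e ∨ (D : ZMod N) = -((q : ZMod N) ^ e)

/-- `QFareyAdj N q x y`: `x = (B, D)` and `y = (B', D')` are reduced fractions `B/D`, `B'/D'` (`D, D' ≥ 1`) with both
denominators in the fibre and `|B D' - B' D|` a power of `q` — the q-FAREY EDGES (for `e = 0` the Farey edges).
LEMMA E (§72.3): adjacent cusps lie in a common `Γ₀(N)`-translate of `𝒵 = ℤ[1/q] ∪ {∞} ∪ W_N ℤ[1/q]`. -/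
def QFareyAdj (N q : ℕ) (x y : ℤ × ℕ) : Prop :=
  0 < x.2 ∧ 0 < y.2 ∧ Int.gcd x.1 x.2 = 1 ∧ Int.gcd y.1 y.2 = 1 ∧ InFibre N q x.2 ∧ InFibre N q y.2 ∧
    ∃ e : ℕ, |x.1 * (y.2 : ℤ) - y.1 * (x.2 : ℤ)| = (q : ℤ) ^ e

/-- **E-an-140 `QFareyFibreConnected N q`** (§72.3): for a prime `q ∤ N`, every reduced fraction `B/D` with
`D mod N ∈ ±⟨q⟩` is joined to `0 = 0/1` by a chain of q-Farey edges inside the fibre.  Equivalent (orbit-graph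
lemma, §72.3) to E-an-141; implies (GEN𝒵).  BC5: HOME/an/g30/QFAREY-an-g30.txt — BFS to height 250–600 for
`(N,q) ∈ {(13,5),(36,5),(20,3),(11,2),(99,2),(91,3)}` (one component up to boundary), one-step descent statistics,
and explicit up-then-down paths for every stubborn start (`99,2`: `D ∈ {17,511}`; `91,3`: `D = 121`).  Why it might
fail: a level `N` with `[(ℤ/N)ˣ : ±⟨q⟩]` large and a fraction whose every q-Farey neighbour in the fibre leads back
— excluded by E-an-141 if [VL] reads as cited; the pure FAREY sub-graph (`e = 0`) IS disconnected (`(13,5)`: 475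
components to height 60), so the `q`-power edges are essential.  Sources: Serre 1970 (Thm 2 Cor. 3); Vaserstein
1972; Liehl 1981; the cell's tables.
TYPER FRAMING (E-an-140): lens an; LAW (obligation node), nothing asserted; THEOREM on paper modulo E-an-141 (now a tree
theorem) by an's orbit-graph lemma; BC5 / REF1 status in the file header. [conjecture — cell candidate, NOT a tree fact] -/
@[conjecture]
def QFareyFibreConnected (N q : ℕ) : Prop :=
  q.Prime → Nat.Coprime q N → 0 < N →
    ∀ (B : ℤ) (D : ℕ), 0 < D → Int.gcd B D = 1 → InFibre N q D →
      Relation.ReflTransGen (QFareyAdj N q) ((0 : ℤ), 1) (B, D)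

/-! ### §4. E-an-141 — Borel + level-N lower unipotents generate the S-congruence group in SL₂(ℤ[1/q]) -/

/-- The ring `ℤ[1/q]`. -/
abbrev Rq (q : ℕ) : Type := Localization.Away (q : ℤ)

/-- The S-congruence group `Γ_S^{±q}(N) = {γ ∈ SL₂(ℤ[1/q]) : γ₁₀ ∈ (N), γ₁₁ ∈ ±q^ℕ + (N)}` as a set
(`q` is a unit mod `N`, so `±q^ℤ + (N) = ±q^ℕ + (N)`). -/
def sCongruenceSet (N q : ℕ) : Set (SL(2, Rq q)) :=
  {γ | (γ : Matrix (Fin 2) (Fin 2) (Rq q)) 1 0 ∈ Ideal.span ({(N : Rq q)} : Set (Rq q)) ∧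
        ∃ e : ℕ, (γ : Matrix (Fin 2) (Fin 2) (Rq q)) 1 1 - (q : Rq q) ^ e ∈ Ideal.span ({(N : Rq q)} : Set (Rq q)) ∨
                 (γ : Matrix (Fin 2) (Fin 2) (Rq q)) 1 1 + (q : Rq q) ^ e ∈ Ideal.span ({(N : Rq q)} : Set (Rq q))}

/-- The generating set: the upper Borel `B⁺(ℤ[1/q])` (lower-left entry `0`) together with the lower unipotents
`U⁻(N ℤ[1/q])`. -/
def borelLowerSet (N q : ℕ) : Set (SL(2, Rq q)) :=
  {γ | (γ : Matrix (Fin 2) (Fin 2) (Rq q)) 1 0 = 0} ∪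
  {γ | (γ : Matrix (Fin 2) (Fin 2) (Rq q)) 0 0 = 1 ∧ (γ : Matrix (Fin 2) (Fin 2) (Rq q)) 1 1 = 1 ∧
        (γ : Matrix (Fin 2) (Fin 2) (Rq q)) 0 1 = 0 ∧
        (γ : Matrix (Fin 2) (Fin 2) (Rq q)) 1 0 ∈ Ideal.span ({(N : Rq q)} : Set (Rq q))}

/-- **E-an-141 `SArithBorelGeneration N q`** (§72.3): for a prime `q ∤ N`, `⟨B⁺(ℤ[1/q]) ∪ U⁻(Nℤ[1/q])⟩ ⊇ Γ_S^{±q}(N)`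
(hence `=`, the generators lying in it).  In print modulo transcription: [VL] Vaserstein, Mat. Sb. 89 (1972) / Liehl,
J. reine angew. Math. 323 (1981) 153–171 (the subgroup of `SL₂(O_S)` generated by the elementary matrices with entries
in a non-zero ideal has finite index when `O_Sˣ` is infinite) + Serre, Ann. of Math. 92 (1970) Thm 2 Cor. 3 with
Prop. 1 (a finite-index subgroup of `SL₂(ℤ[1/q])` contains a principal S-congruence subgroup) + the mod-`M` computation
of §72.3 (Whitehead's `h(1+xy)` identity).  Why it might fail: only if [VL]'s printed hypotheses exclude the
unnormalised level-`N` elementary subgroup (texts not held: WANTED) — the integral analogue (`ℤ` for `ℤ[1/q]`) is FALSE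
for `N ≥ 5` (`⟨T, L_N⟩` free of infinite index), which is exactly why the FAREY sub-graph of §3 is disconnected.
TYPER FRAMING (E-an-141): typed as an obligation node (nothing asserted here) and PROVED in the sibling `TowerExtensionHolds.lean`
(`sArithBorelGeneration_holds`, from the tree's Vaserstein theorem `SL2Rel.Away.relG_top_span_natCast_le_relE` — no [VL]
finite-index fact, no congruence subgroup property needed). [conjecture — cell candidate, NOT a tree fact] -/
@[conjecture]
def SArithBorelGeneration (N q : ℕ) : Prop :=
  q.Prime → Nat.Coprime q N → 0 < N →
    sCongruenceSet N q ⊆ (Subgroup.closure (borelLowerSet N q) : Set (SL(2, Rq q)))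

/-- The orbit-graph edge E-an-141 ⟹ E-an-140 (§72.3: `Γ_S^{±q}(N)` is transitive on the fibre, the q-Farey edge set
is `SL₂(ℤ[1/q])`-invariant, `Stab(0) ∪ {edge elements}` generates `B⁺ ∪ U⁻(N·)` up to the Weyl flip), as a Prop. -/
def BorelGenerationImpliesConnected : Prop :=
  ∀ N q : ℕ, SArithBorelGeneration N q → QFareyFibreConnected N q

/-! ### §6. E-an-142 — CELL-FREE TV-pattern rigidity (an g30 MEMO-an §72.9; APPEND T-an-34″, typer g15; source sha16 43bd003eb6244594 §6 VERBATIM + two proved typer edges) -/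

/-- **E-an-142 `TVPatternRigidity N q p` — CELL-FREE TV-pattern rigidity** (MEMO §72.9; evidence table EXC-an-g30.txt; replaces (EV_q) in THEOREM Z)
`g n r` stands for `G(r/qⁿ) = d⁻¹φ⁺({0, r/qⁿ}) mod p` (all `r : ℤ`, non-reduced fractions allowed), `c γ` for the cocycle value `G(γ0)`.
The hypotheses are exactly (F1) (F2) (F5) evenness, non-reduction, TV from level `s+1` on, and Γ₀(N)-invariance on pairs `x, γx ∈ ℤ[1/q]`;
the conclusion says the only surviving patterns are LEVEL-LINEAR, `G(r/qⁿ) = κ'·n` — which telescope to `c|Γ₁(N) = 0` along q-Farey paths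
(E-an-143, paper, from E-an-140), contradicting `p ∤ d`.  No (EV_q), no Chebotarev cell: every admissible `q ≥ 5` would do.
TYPER FRAMING (E-an-142): lens an; the schema (plain `def`; vacuously true at non-prime `p`, no junk); the LAW row is
`TVPatternRigidityLaw p` below (obligation node, nothing asserted); BC5 = HOME/an/g30/EXC-an-g30.txt 1696118b1d424cb9 (21/21
admissible runs decided, 0 exceptions), BC7 g30-bc7c CLEAN; REF1 R-an-52 PENDING at filing. -/
def TVPatternRigidity (N q p : ℕ) : Prop :=
  q.Prime → 5 ≤ q → ¬ q ∣ p * N → ¬ p ∣ (q - 1) / 2 → 0 < N →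
  ∀ (a κ : ZMod p) (s : ℕ) (g : ℕ → ℤ → ZMod p) (c : SL(2, ℤ) → ZMod p),
    (∀ r, g 0 r = 0) →
    (∀ n r, g n (r + (q : ℤ) ^ n) = g n r) →
    (∀ n r, g (n + 1) ((q : ℤ) * r) = g n r) →
    (∀ n r, g n (-r) = g n r) →
    (∀ n r, s + 1 ≤ n → IsCoprime r (q : ℤ) → g n (r + (q : ℤ) ^ (n - 1)) = g n r) →
    (κ = ∑ t ∈ Finset.range q, g 1 (t : ℤ)) →
    (∀ (m : ℕ) (r : ℤ), ∑ t ∈ Finset.range q, g (m + 1) (r + (t : ℤ) * (q : ℤ) ^ m) = a * g m r - g (m - 1) r + κ) →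
    (∀ γ : SL(2, ℤ), (N : ℤ) ∣ (γ : Matrix (Fin 2) (Fin 2) ℤ) 1 0 →
        ∀ (r : ℤ) (i j : ℕ) (ε : ℤˣ),
          (γ : Matrix (Fin 2) (Fin 2) ℤ) 1 0 * r + (γ : Matrix (Fin 2) (Fin 2) ℤ) 1 1 * (q : ℤ) ^ i = (ε : ℤ) * (q : ℤ) ^ j →
          g j ((ε : ℤ) * ((γ : Matrix (Fin 2) (Fin 2) ℤ) 0 0 * r + (γ : Matrix (Fin 2) (Fin 2) ℤ) 0 1 * (q : ℤ) ^ i)) - g i r = c γ) →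
    ∃ κ' : ZMod p, ∀ (n : ℕ) (r : ℤ), IsCoprime r (q : ℤ) → g n r = κ' * (n : ZMod p)

/-- **E-an-142 as a LAW over all levels and admissible primes** (obligation node, nothing asserted; an g30 MEMO-an §72.9: «the SINGLE
remaining LAW for the tower input of C3/C2 in EVERY cell»). [conjecture — cell candidate, NOT a tree fact] -/
@[conjecture]
def TVPatternRigidityLaw (p : ℕ) : Prop := ∀ N q : ℕ, TVPatternRigidity N q p

/-- The tower conjecture restricted to `q ≥ 5` (the composite-lift / pattern arguments need `q ≥ 5`). -/
def TowerUnitTwistGeFive (p : ℕ) : Prop :=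
  ∀ (W : WeierstrassCurve ℚ) [W.IsElliptic] {N : ℕ} [NeZero N] (f : CuspForm (CongruenceSubgroup.Gamma0 N) 2),
    IsNewformOf W f → PlusIndexPrimeTo p f →
    ∀ (q : ℕ) [Fact q.Prime], 5 ≤ q → q ≠ p → ¬ q ∣ N → ¬ p ∣ (q - 1) / 2 →
      ∀ n₁ : ℕ, ∃ n : ℕ, n₁ ≤ n ∧ ∃ χ : DirichletCharacter ℂ (q ^ n), χ.IsPrimitive ∧ χ.Even ∧ UnitTwistAt p W f χ

/-- The assembled edge (paper: §71.3 TV descent [landed p666647] + E-an-142 + E-an-143 telescoping + E-an-140 [theorem, §72.6]):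
pattern rigidity gives the tower conjecture at every admissible `q ≥ 5`, in every cell. -/
def RigidityImpliesTower : Prop := ∀ p : ℕ, p.Prime → TVPatternRigidityLaw p → TowerUnitTwistGeFive p

/-- **Typer edge (PROVED):** the full tower law E-an-135 trivially gives its `q ≥ 5` restriction. -/
theorem towerUnitTwistGeFive_of_towerUnitTwist {p : ℕ} (h : TowerUnitTwist p) : TowerUnitTwistGeFive p := by
  intro W _ N _ f hW hpi q _ hq5 hqp hqN hpdiv n₁
  exact h W f hW hpi q (by omega) hqp hqN hpdiv n₁

/-- **Typer edge (PROVED):** the `q ≥ 5` tower law gives the ∃q-form E-an-135♭ `KatoCurve.SomeTowerUnitTwist p` — Dirichlet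
(Mathlib `Nat.forall_exists_prime_gt_and_modEq`) supplies primes `q ≡ −1 (mod 4p)` beyond any bound; such `q` has `q + 1 = 4pj`,
so `q ≥ 7`, `q ≠ p`, `q ∤ N` (take `q > N`) and `p ∤ (q−1)/2 = 2pj − 1`.  Hence an's chain reads
`TVPatternRigidityLaw p ⟹ (RigidityImpliesTower, paper) TowerUnitTwistGeFive p ⟹ SomeTowerUnitTwist p ⟹ (p2's retyped reductions) E-es-66 / 66₂`. -/
theorem someTowerUnitTwist_of_geFive {p : ℕ} (hT : TowerUnitTwistGeFive p) : SomeTowerUnitTwist p := by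
  intro hp W _ N _ f hW hpi N₀
  have hp2 : 2 ≤ p := hp.two_le
  have h4p : 4 * p ≠ 0 := by omega
  have hcop : (4 * p - 1).Coprime (1 + (4 * p - 1)) := Nat.coprime_add_self_right.mpr (Nat.coprime_one_right _)
  have h41 : 1 + (4 * p - 1) = 4 * p := by omega
  rw [h41] at hcop
  obtain ⟨q, hqgt, hq, hqmod⟩ := Nat.forall_exists_prime_gt_and_modEq (N₀ + N + p) h4p hcop
  have hmod : q % (4 * p) = 4 * p - 1 := by
    rw [Nat.ModEq] at hqmod; rw [hqmod]; exact Nat.mod_eq_of_lt (by omega)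
  have hdiv := Nat.div_add_mod q (4 * p)
  set k := q / (4 * p) with hk
  set M := p * (k + 1) with hM
  have hqM : q + 1 = 4 * M := by
    rw [hmod] at hdiv
    have h1 : 1 ≤ 4 * p := by omega
    zify [h1] at hdiv ⊢
    rw [hM]; push_cast
    linear_combination -hdiv
  have hpM : p ≤ M := by rw [hM]; exact Nat.le_mul_of_pos_right p (Nat.succ_pos k)
  have hNpos : 0 < N := Nat.pos_of_ne_zero (NeZero.ne N)
  have hq5 : 5 ≤ q := by omega
  have hqp : q ≠ p := by omega
  have hqN : ¬ q ∣ N := fun h => by have := Nat.le_of_dvd hNpos h; omega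
  have hhalf : (q - 1) / 2 = 2 * M - 1 := by omega
  have hpdiv : ¬ p ∣ (q - 1) / 2 := by
    rw [hhalf]
    intro h
    have h2M : p ∣ 2 * M := ⟨2 * (k + 1), by rw [hM]; ring⟩
    have h1 : p ∣ 2 * M - (2 * M - 1) := Nat.dvd_sub h2M h
    have : 2 * M - (2 * M - 1) = 1 := by omega
    rw [this] at h1
    exact hp.one_lt.ne' (Nat.dvd_one.mp h1)
  haveI : Fact q.Prime := ⟨hq⟩
  exact ⟨q, ⟨hq⟩, by omega, by omega, hqp, hqN, hpdiv, fun n₁ => hT W f hW hpi q hq5 hqp hqN hpdiv n₁⟩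

end Summit.BirchSwinnertonDyer.Rank1Residual.ManinAdditive.TowerExtension

end
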